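import Summits.ValiantsHypothesis.ValiantsHypothesis.Theorems.LacunarySymmetroidMatrixDescartesCensusSupportDescartes
import Summits.ValiantsHypothesis.ValiantsHypothesis.Theorems.LacunarySymmetroidMatrixDescartesCensusSupportNormalForm
import Summits.ValiantsHypothesis.ValiantsHypothesis.Theorems.LacunarySymmetroidMatrixDescartesCensusDefs

/-!
# `MatrixDescartes` census — reductions for the BOX20 theorem (translation of exponents; repeated exponents)

HONEST FRAMING.  Object-search cell `pub-symmetroid`, crux `Theses.LacunarySymmetroid.MatrixDescartes`
(stmt-ValiantsHypothesis-18050).  Two bookkeeping lemmas used by `…CensusBox20.lean` to pass from sorted supports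
`0 = d₀ < ⋯ < d₅ ≤ 20` to arbitrary exponent vectors in a window of width `20`: a common shift of the exponents multiplies the
pencil by a monomial and keeps the positive roots (`posRootLawOn_add_const_iff`, via `Census.posRoots_X_pow_mul_eq`), and a REPEATED
exponent leaves at most `15` distinct pair sums (`card_pairSums_le_of_not_injective`, via the triangle count
`two_mul_card_filter_le_sq`), so such supports fall under the support-level Descartes bound `Census.posRoots_two_le_of_card_pairSums`.
Nothing here bears on `DoorA26` (OPEN), on the crux, or on `VP ≠ VNP`.

[folklore] Elementary.
-/

-- `Summit.ValiantsHypothesis.ValiantsHypothesis.…` repeats a component by the D-0017 layout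
-- (single-conjunct summit), which the `dupNamespace` linter flags; the name is mandated.
set_option linter.dupNamespace false

namespace Summit.ValiantsHypothesis.ValiantsHypothesis.Theorems.LacunarySymmetroidMatrixDescartes.Census

open Polynomial Finset
open scoped BigOperators Polynomial Matrix
open Summit.ValiantsHypothesis.ValiantsHypothesis.Theorems.MatrixDescartes.Negative (PosRootLawAt)

/-- Translating all exponents by `c` multiplies the pencil by `X^c`; positive roots are unchanged. [folklore] -/
theorem posRootLawOn_add_const_iff {m K B : ℕ} (d : Fin K → ℕ) (c : ℕ) :
    PosRootLawOn m K B (fun l => d l + c) ↔ PosRootLawOn m K B d := by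
  have key : ∀ S : Fin K → Matrix (Fin m) (Fin m) ℝ,
      (∑ l, (X : ℝ[X]) ^ (d l + c) • (S l).map C) = (X : ℝ[X]) ^ c • ∑ l, (X : ℝ[X]) ^ d l • (S l).map C := by
    intro S
    rw [Finset.smul_sum]
    refine Finset.sum_congr rfl fun l _ => ?_
    rw [smul_smul, ← pow_add, add_comm]
  have hdet : ∀ S : Fin K → Matrix (Fin m) (Fin m) ℝ,
      (∑ l, (X : ℝ[X]) ^ (d l + c) • (S l).map C).det = (X : ℝ[X]) ^ (c * m) * (∑ l, (X : ℝ[X]) ^ d l • (S l).map C).det := by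
    intro S
    rw [key, Matrix.det_smul, Fintype.card_fin, ← pow_mul]
  constructor
  · intro h S hS
    have := h S hS
    simp only at this
    rw [hdet, posRoots_X_pow_mul_eq] at this
    exact this
  · intro h S hS
    show ((∑ l, (X : ℝ[X]) ^ (d l + c) • (S l).map C).det.roots.toFinset.filter (fun t => 0 < t)).card ≤ B
    rw [hdet, posRoots_X_pow_mul_eq]
    exact h S hS

/-- The «upper triangle» of `U × U` has at most `|U|(|U|+1)/2` elements. [folklore] -/
theorem two_mul_card_filter_le_sq (U : Finset ℕ) :
    2 * ((U ×ˢ U).filter (fun q : ℕ × ℕ => q.1 ≤ q.2)).card ≤ U.card * (U.card + 1) := by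
  classical
  induction U using Finset.induction_on with
  | empty => simp
  | @insert a U ha ih =>
    have hsplit : ((insert a U ×ˢ insert a U).filter (fun q : ℕ × ℕ => q.1 ≤ q.2))
        ⊆ ((U ×ˢ U).filter (fun q : ℕ × ℕ => q.1 ≤ q.2)) ∪ ((insert a U).image (fun b => (min a b, max a b))) := by
      intro q hq
      simp only [Finset.mem_filter, Finset.mem_product, Finset.mem_insert] at hq
      obtain ⟨⟨h1, h2⟩, hle⟩ := hq
      simp only [Finset.mem_union, Finset.mem_filter, Finset.mem_product, Finset.mem_image, Finset.mem_insert]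
      rcases h1 with h1 | h1
      · right; exact ⟨q.2, h2, by rw [← h1, min_eq_left hle, max_eq_right hle]⟩
      · rcases h2 with h2 | h2
        · right; refine ⟨q.1, Or.inr h1, ?_⟩
          rw [← h2, min_eq_right hle, max_eq_left hle]
        · left; exact ⟨⟨h1, h2⟩, hle⟩
    have hc : ((insert a U ×ˢ insert a U).filter (fun q : ℕ × ℕ => q.1 ≤ q.2)).card
        ≤ ((U ×ˢ U).filter (fun q : ℕ × ℕ => q.1 ≤ q.2)).card + (U.card + 1) :=
      calc ((insert a U ×ˢ insert a U).filter (fun q : ℕ × ℕ => q.1 ≤ q.2)).card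
          ≤ (((U ×ˢ U).filter (fun q : ℕ × ℕ => q.1 ≤ q.2)) ∪ ((insert a U).image (fun b => (min a b, max a b)))).card :=
            Finset.card_le_card hsplit
        _ ≤ ((U ×ˢ U).filter (fun q : ℕ × ℕ => q.1 ≤ q.2)).card + ((insert a U).image (fun b => (min a b, max a b))).card :=
            Finset.card_union_le _ _
        _ ≤ ((U ×ˢ U).filter (fun q : ℕ × ℕ => q.1 ≤ q.2)).card + (insert a U).card :=
            Nat.add_le_add_left Finset.card_image_le _
        _ = ((U ×ˢ U).filter (fun q : ℕ × ℕ => q.1 ≤ q.2)).card + (U.card + 1) := by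
            rw [Finset.card_insert_of_notMem ha]
    rw [Finset.card_insert_of_notMem ha]
    nlinarith [ih, hc]

/-- A repeated exponent leaves at most `15 ≤ 20` distinct pair sums: the pair-sum table of a `6`-tuple taking at most `5`
values has at most `15` entries. [folklore] -/
theorem card_pairSums_le_of_not_injective (d : Fin 6 → ℕ) (hd : ¬ Function.Injective d) :
    ((Finset.univ : Finset (Fin 6 × Fin 6)).image (fun p => d p.1 + d p.2)).card ≤ 19 + 1 := by
  classical
  set T : Finset ℕ := Finset.univ.image d with hT
  have hTcard : T.card ≤ 5 := by
    have h6 : T.card ≤ (Finset.univ : Finset (Fin 6)).card := Finset.card_image_le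
    have hne : T.card ≠ (Finset.univ : Finset (Fin 6)).card := by
      intro heq
      apply hd
      have hinj : Set.InjOn d ↑(Finset.univ : Finset (Fin 6)) := Finset.card_image_iff.mp heq
      exact Set.injOn_univ.mp (by simpa using hinj)
    simp only [Finset.card_univ, Fintype.card_fin] at h6 hne
    omega
  have hsub : (Finset.univ : Finset (Fin 6 × Fin 6)).image (fun p => d p.1 + d p.2)
      ⊆ ((T ×ˢ T).filter (fun q : ℕ × ℕ => q.1 ≤ q.2)).image (fun q => q.1 + q.2) := by
    intro x hx
    simp only [Finset.mem_image, Finset.mem_univ, true_and, Finset.mem_filter, Finset.mem_product, hT] at hx ⊢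
    obtain ⟨p, rfl⟩ := hx
    rcases le_total (d p.1) (d p.2) with h | h
    · exact ⟨(d p.1, d p.2), ⟨⟨⟨p.1, rfl⟩, ⟨p.2, rfl⟩⟩, h⟩, rfl⟩
    · exact ⟨(d p.2, d p.1), ⟨⟨⟨p.2, rfl⟩, ⟨p.1, rfl⟩⟩, h⟩, add_comm _ _⟩
  have htri := two_mul_card_filter_le_sq T
  have h30 : T.card * (T.card + 1) ≤ 5 * 6 := Nat.mul_le_mul hTcard (by omega)
  have := (Finset.card_le_card hsub).trans Finset.card_image_le
  omega

end Summit.ValiantsHypothesis.ValiantsHypothesis.Theorems.LacunarySymmetroidMatrixDescartes.Census
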